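import Mathlib.Topology.Basic
import Literature.Analysis.FunctionSpaces.DiagonalSubsequence
import HarnessLib

/-!
# Diagonal extraction for hereditary subsequence properties (support for stub `stub_flavouredThreshold`)
(line `block-away-the-sign`, crux `Summit.QuantumFields.QCD.Theses.SpectralDefectExtinction.ExtinctionBuildsQCD`,
item stmt-QuantumFields-18064)

The reshaped (cycle-1 → wave-2) interface between Stub C (`stub_seaCore`) and Stub T (`stub_flavouredThreshold`)
of the line hands over the gluonic core package HEREDITARILY in the subsequence: for every mass tuple `m` above
the threshold and every strictly increasing `ψ : ℕ → ℕ` there is a further extraction `φ` such that the package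
(lattice `n`-point functions converging along `ψ ∘ φ`, plus subsequence-independent clauses) holds along
`ψ ∘ φ`.  This file isolates the purely order-theoretic step by which Stub T assembles ONE subsequence serving
countably many tuples at once (Cantor's diagonal procedure), in three forms:

* `diagonal_of_hereditary` — countably many properties `P i` of subsequences, each HEREDITARY (every strictly
  increasing `ψ` has a further extraction `φ` with `P i (ψ ∘ φ)`) and TAIL-STABLE (if `P i θ` and the strictly
  increasing `φ` agrees from some rank on with `θ ∘ φ'`, `φ'` strictly increasing, then `P i φ`), hold
  simultaneously along `ψ ∘ φ` for one strictly increasing `φ`, for every strictly increasing `ψ` (so the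
  conclusion is again hereditary);
* `exists_strictMono_forall_tendsto_of_hereditary` — the specialisation to "the sequence `u i` has a limit along
  the subsequence" in arbitrary topological spaces;
* `diagonal_of_hereditary_tendsto` — the specialisation to packages of the shape Stub T consumes: data `d`
  (renormalisation constants, OS data, a rate) such that a family of sequences depending on `d` converges along
  the subsequence to limits depending on `d`, together with a subsequence-independent side condition `R i d`.

The engine is the tree's `Literature.Analysis.FunctionSpaces.exists_strictMono_forall_of_extraction'`
(nested extractions `τₙ = τₙ₋₁ ∘ ψₙ` and the diagonal `k ↦ τ_k k`); the only additions are the relative form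
(an arbitrary ambient `ψ`), the bookkeeping that the comparison sequences in the tail-stability hypothesis may be
taken strictly increasing, and the `Tendsto` instances.  What the diagonal does NOT supply is recorded in the
stub's dossier: tuples off the countable set need equicontinuity in the mass (route HeavyThresholdYMBridge,
informal support MassEquicontinuity, stmt-QuantumFields-8884).

References: G. Seregin, *Lecture Notes on Regularity Theory for the Navier–Stokes Equations* (2014), App. B §B.4
(the diagonal procedure); J. Leray, Acta Math. 63 (1934), §13 ("procédé diagonal de Cantor").
-/

namespace Summit.QuantumFields.QCD.Cruxes.ExtinctionBuildsQCD.BlockAwayTheSign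

open Filter Topology
open Literature.Analysis.FunctionSpaces (exists_strictMono_forall_of_extraction' tendsto_of_eventually_eq_comp)

section Diagonal

variable {ι : Type*} [Countable ι]

/-- Eventual reparametrisations compose: if `χ k = χ₀ (ρ k)` for all large `k` and `χ' k = χ (ρ' k)` for all
large `k`, with `ρ'` strictly increasing, then `χ' k = χ₀ (ρ (ρ' k))` for all large `k`. -/
theorem eventually_eq_comp_trans {χ₀ χ χ' ρ ρ' : ℕ → ℕ} (hρ' : StrictMono ρ')
    (h₁ : ∀ᶠ k in atTop, χ k = χ₀ (ρ k)) (h₂ : ∀ᶠ k in atTop, χ' k = χ (ρ' k)) :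
    ∀ᶠ k in atTop, χ' k = χ₀ (ρ (ρ' k)) := by
  filter_upwards [h₂, hρ'.tendsto_atTop.eventually h₁] with k hk hk'
  rw [hk, hk']

/-- **Cantor's diagonal for countably many hereditary, tail-stable properties of subsequences.**  Let `P i`
(`i` in a countable type) be properties of maps `ℕ → ℕ` such that
* (hereditary) every strictly increasing `ψ` admits a strictly increasing `φ` with `P i (ψ ∘ φ)`;
* (tail-stable) if `θ`, `φ` are strictly increasing, `P i θ` holds, and from some rank `N` on `φ` is the
  reparametrisation `φ n = θ (φ' n)` of `θ` by a strictly increasing `φ'`, then `P i φ`.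
Then for every strictly increasing `ψ` there is ONE strictly increasing `φ` with `P i (ψ ∘ φ)` for all `i`.
(Nested extractions and the diagonal, which from rank `n` on is a subsequence of the `n`-th extraction:
the tree's `exists_strictMono_forall_of_extraction'`, applied to the auxiliary property "is eventually a
strictly increasing reparametrisation of a strictly increasing sequence along which `P i` holds".) -/
theorem diagonal_of_hereditary {P : ι → (ℕ → ℕ) → Prop}
    (hher : ∀ i (ψ : ℕ → ℕ), StrictMono ψ → ∃ φ : ℕ → ℕ, StrictMono φ ∧ P i (ψ ∘ φ))
    (htail : ∀ i (θ φ : ℕ → ℕ), StrictMono θ → StrictMono φ → P i θ →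
      (∃ N : ℕ, ∃ φ' : ℕ → ℕ, StrictMono φ' ∧ ∀ n, N ≤ n → φ n = θ (φ' n)) → P i φ) :
    ∀ ψ : ℕ → ℕ, StrictMono ψ → ∃ φ : ℕ → ℕ, StrictMono φ ∧ ∀ i, P i (ψ ∘ φ) := by
  intro ψ hψ
  -- auxiliary property: `χ` is eventually a strictly increasing reparametrisation of a strictly increasing
  -- `χ₀` along which (after composing with the ambient `ψ`) `P i` holds
  let Q : ι → (ℕ → ℕ) → Prop := fun i χ => ∃ χ₀ ρ : ℕ → ℕ, StrictMono χ₀ ∧ StrictMono ρ ∧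
    (∀ᶠ k in atTop, χ k = χ₀ (ρ k)) ∧ P i (ψ ∘ χ₀)
  have hsub : ∀ i (χ χ' : ℕ → ℕ),
      (∃ ρ' : ℕ → ℕ, StrictMono ρ' ∧ ∀ᶠ k in atTop, χ' k = χ (ρ' k)) → Q i χ → Q i χ' := by
    rintro i χ χ' ⟨ρ', hρ', h'⟩ ⟨χ₀, ρ, hχ₀, hρ, h, hP⟩
    exact ⟨χ₀, ρ ∘ ρ', hχ₀, hρ.comp hρ', eventually_eq_comp_trans (ρ := ρ) (ρ' := ρ') hρ' h h', hP⟩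
  have hex : ∀ i (χ : ℕ → ℕ), StrictMono χ → ∃ φ : ℕ → ℕ, StrictMono φ ∧ Q i (χ ∘ φ) := by
    intro i χ hχ
    obtain ⟨φ, hφ, hP⟩ := hher i (ψ ∘ χ) (hψ.comp hχ)
    exact ⟨φ, hφ, χ ∘ φ, id, hχ.comp hφ, strictMono_id, Eventually.of_forall fun _ => rfl, hP⟩
  obtain ⟨φ, hφ, hQ⟩ := exists_strictMono_forall_of_extraction' hsub hex
  refine ⟨φ, hφ, fun i => ?_⟩
  obtain ⟨χ₀, ρ, hχ₀, hρ, h, hP⟩ := hQ i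
  obtain ⟨N, hN⟩ := eventually_atTop.1 h
  exact htail i (ψ ∘ χ₀) (ψ ∘ φ) (hψ.comp hχ₀) (hψ.comp hφ) hP
    ⟨N, ρ, hρ, fun n hn => by simp only [Function.comp_apply, hN n hn]⟩

/-- **Common convergent subsequence for countably many hereditarily convergent sequences.**  If for every `i`
and every strictly increasing `ψ` the sequence `u i ∘ ψ` has a convergent subsequence, then every strictly
increasing `ψ` admits ONE strictly increasing `φ` along which every `u i ∘ ψ ∘ φ` converges (arbitrary
topological spaces; convergence passes to eventual reparametrisations by strictly increasing maps). -/
theorem exists_strictMono_forall_tendsto_of_hereditary {X : ι → Type*} [∀ i, TopologicalSpace (X i)]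
    (u : ∀ i, ℕ → X i)
    (hher : ∀ i (ψ : ℕ → ℕ), StrictMono ψ → ∃ φ : ℕ → ℕ, StrictMono φ ∧ ∃ l : X i,
      Tendsto (fun j => u i (ψ (φ j))) atTop (𝓝 l)) :
    ∀ ψ : ℕ → ℕ, StrictMono ψ → ∃ φ : ℕ → ℕ, StrictMono φ ∧ ∀ i, ∃ l : X i,
      Tendsto (fun j => u i (ψ (φ j))) atTop (𝓝 l) := by
  refine diagonal_of_hereditary
    (P := fun i θ => ∃ l : X i, Tendsto (fun j => u i (θ j)) atTop (𝓝 l)) hher ?_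
  rintro i θ φ - - ⟨l, hl⟩ ⟨N, φ', hφ', hN⟩
  exact ⟨l, tendsto_of_eventually_eq_comp hφ' (eventually_atTop.2 ⟨N, hN⟩) hl⟩

/-- **Diagonal extraction for hereditary convergence packages with data** (the shape Stub T consumes).  For
each `i` let a package consist of data `d : D i` such that every member `t : τ i` of a family of sequences
`G i d t : ℕ → X i t` (which may depend on `d`) converges along the subsequence to `ℓ i d t`, together with a
subsequence-independent side condition `R i d`.  If for every `i` every strictly increasing `ψ` admits a further
extraction carrying such a package, then every strictly increasing `ψ` admits ONE strictly increasing `φ` such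
that for every `i` some package holds along `ψ ∘ φ`. -/
theorem diagonal_of_hereditary_tendsto {D : ι → Type*} {τ : ι → Type*} {X : ∀ i, τ i → Type*}
    [∀ i t, TopologicalSpace (X i t)] (G : ∀ i, D i → ∀ t : τ i, ℕ → X i t)
    (ℓ : ∀ i, D i → ∀ t : τ i, X i t) (R : ∀ i, D i → Prop)
    (hher : ∀ i (ψ : ℕ → ℕ), StrictMono ψ → ∃ φ : ℕ → ℕ, StrictMono φ ∧ ∃ d : D i,
      (∀ t, Tendsto (fun j => G i d t (ψ (φ j))) atTop (𝓝 (ℓ i d t))) ∧ R i d) :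
    ∀ ψ : ℕ → ℕ, StrictMono ψ → ∃ φ : ℕ → ℕ, StrictMono φ ∧ ∀ i, ∃ d : D i,
      (∀ t, Tendsto (fun j => G i d t (ψ (φ j))) atTop (𝓝 (ℓ i d t))) ∧ R i d := by
  refine diagonal_of_hereditary
    (P := fun i θ => ∃ d : D i, (∀ t, Tendsto (fun j => G i d t (θ j)) atTop (𝓝 (ℓ i d t))) ∧ R i d)
    hher ?_
  rintro i θ φ - - ⟨d, hd, hR⟩ ⟨N, φ', hφ', hN⟩
  exact ⟨d, fun t => tendsto_of_eventually_eq_comp hφ' (eventually_atTop.2 ⟨N, hN⟩) (hd t), hR⟩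

end Diagonal

/-- **Registered sub-goal `stub_flavouredThresholdDiagonal` (Tools sub-goal of Stub T: Cantor's diagonal for hereditary
subsequence packages).**  (1) Countably many hereditary, tail-stable properties of subsequences hold simultaneously along
one further extraction of any given strictly increasing `ψ` (`diagonal_of_hereditary`); (2) the same for hereditary
convergence packages with data and a subsequence-independent side condition (`diagonal_of_hereditary_tendsto`) — the
shape of the reshaped core package handed from Stub C to Stub T, which thereby serves every tuple of a countable
(dense) set of mass tuples along ONE subsequence `reg ∘ φ`.  [Seregin2014 App. B §B.4; Leray1934 §13] -/
theorem stub_flavouredThresholdDiagonal : (∀ {ι : Type} [Countable ι] {P : ι → (ℕ → ℕ) → Prop}, (∀ (i : ι) (ψ : ℕ → ℕ), StrictMono ψ → ∃ φ : ℕ → ℕ, StrictMono φ ∧ P i (ψ ∘ φ)) → (∀ (i : ι) (θ φ : ℕ → ℕ), StrictMono θ → StrictMono φ → P i θ → (∃ N : ℕ, ∃ φ' : ℕ → ℕ, StrictMono φ' ∧ ∀ n, N ≤ n → φ n = θ (φ' n)) → P i φ) → ∀ ψ : ℕ → ℕ, StrictMono ψ → ∃ φ : ℕ → ℕ, StrictMono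 φ ∧ ∀ i, P i (ψ ∘ φ)) ∧ (∀ {ι : Type} [Countable ι] {D : ι → Type} {τ : ι → Type} {X : ∀ i, τ i → Type} [∀ i t, TopologicalSpace (X i t)] (G : ∀ i, D i → ∀ t : τ i, ℕ → X i t) (ℓ : ∀ i, D i → ∀ t : τ i, X i t) (R : ∀ i, D i → Prop), (∀ (i : ι) (ψ : ℕ → ℕ), StrictMono ψ → ∃ φ : ℕ → ℕ, StrictMono φ ∧ ∃ d : D i, (∀ t, Filter.Tendsto (fun j => G i d t (ψ (φ j))) Filter.atTop (nhds (ℓ i d t))) ∧ R i d) → ∀ ψ : ℕ → ℕ, StrictMono ψ → ∃ φ : ℕ → ℕ, StrictMono φ ∧ ∀ i, ∃ d : D i, (∀ t, Filter.Tendsto (fun j => G i d t (ψ (φ j))) Filter.atTop (nhds (ℓ i d t))) ∧ R i d) :=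
  ⟨fun hher htail => diagonal_of_hereditary hher htail,
    fun G ℓ R hher => diagonal_of_hereditary_tendsto G ℓ R hher⟩

end Summit.QuantumFields.QCD.Cruxes.ExtinctionBuildsQCD.BlockAwayTheSign
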